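import Mathlib
import HarnessLib
import Summits.NavierStokesRegularity.NavierStokesRegularity.Theorems.UnthreadedDoorPotentialEvolutionCore

/-!
# Route UnthreadedRigidityDoor · crux `UnthreadedRigidity` (stmt-NavierStokesRegularity-27585) · LINE «jet rigidity»
# (planner ns-idea-6 g5, birth skeleton sha16 `5d320f85a8de9ffc`) — the (E1)-half of `stub_windowPotentialLaw`:
# the exact evolution law of the toroidal potential on an OPEN TIME WINDOW

Seat ns-qj-p1 g3 (next-free-hand slot of DIRECTOR-NS #219), `--supports stmt-NavierStokesRegularity-27585 --as helper`.
The registered stub `StubWindowPotentialLaw` asks, for a classical solution `u` of the vorticity formulation on an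
open window `S` that is unthreaded about `x₀`, for a toroidal potential `T` (construction — NOT in this file) AND
for the law
      `∇(∂ₜT + ⟪u, ∇T⟫ − ΔT) × (x − x₀) = ∇⟪u, x − x₀⟫ × ∇T`   on `S × (ℝ³ ∖ {x₀})`.            (E1)
This file proves (E1) for ANY potential representing the vorticity (`curl u(t) = ∇T(t) × (x − x₀)` on `S × ℝ³`,
`T` jointly smooth on `S × (ℝ³ ∖ {x₀})`): it is the open-window form of the seat's 1222 theorems
`…PoloidalLiouville.cross_gradient_potential_of_local` / `….potentialEvolution` (files
`UnthreadedDoorPotentialEvolutionCore` / `UnthreadedDoorPotentialEvolution`, window `(−∞,0)`), whose proofs were already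
written against an abstract open time set; the coordinate algebra (`cross_eq_of_vorticity_identity`, the cofactor
identity `(Mᵀa) × y + a × (Mᵀy) + M(a × y) = (tr M)(a × y)` with `tr Dv = div v = 0`) is IMPORTED from the Core file,
not restated.

* `cross_gradient_potential_of_local_of_isOpen` — core computation for a potential smooth on the whole slab
  `S × ℝ³` representing `curl u` near the point (vorticity equation at `(t,x)` with `ω = ∇Θ × y`; Schwarz for `∂ₜ`/`Δ`
  through `∇`; the Hessian-symmetry cancellation `Σᵢ ∂ᵢ∇Θ × eᵢ = 0`; the cofactor identity);
* `potentialEvolution_of_isOpen` — the law for a potential smooth on the punctured slab, by localisation with a bump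
  (the (E1)-half of `StubWindowPotentialLaw`, with its binders and conclusion verbatim).

HONEST FRAMING: an exact identity for HYPOTHETICAL unthreaded window solutions (local blow-up profiles); the
potential-half of the stub (existence of `T`) and the wall `stub_shearedRigidity` are NOT addressed here; nothing
here bears on `UnthreadedRigidity`, the door Target, or Navier–Stokes regularity; no summit statement is proved.
[folklore]

References: A. J. Majda, A. L. Bertozzi, *Vorticity and Incompressible Flow* (CUP 2002) §1.1, Prop. 2.4 eq. (2.110).
-/

noncomputable section

-- the summit and its single sub-problem share the name (CONVENTIONS §1), as in every Theorems file
set_option linter.dupNamespace false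

namespace Summit.NavierStokesRegularity.NavierStokesRegularity.Theorems.PoloidalLiouville

open MeasureTheory Set Function Filter
open _root_.Topology
open scoped RealInnerProductSpace InnerProductSpace ContDiff Laplacian
open Literature.Analysis.FluidPDE

variable {v : ℝ → (EuclideanSpace ℝ (Fin 3)) → (EuclideanSpace ℝ (Fin 3))}

/-! ### The core computation on an open window -/

/-- **The evolution law on an open window, core form** (open-window version of
`cross_gradient_potential_of_local`): `v` solves the vorticity formulation on an open `S`, `Θ` is jointly smooth on
`S × ℝ³` with `curl v(s) = ∇Θ(s) × (· − x₀)` for `s ∈ S` on a neighbourhood of `x`; then at `(t, x)`, `t ∈ S`: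
`∇(∂ₜΘ + ⟪v, ∇Θ⟫ − ΔΘ) × (x − x₀) = ∇⟪v, · − x₀⟫ × ∇Θ`. Same proof: vorticity equation with `ω = ∇Θ × y`, Schwarz,
Hessian symmetry, and the cofactor identity with `tr Dv = div v = 0` (`cross_eq_of_vorticity_identity`). [folklore] -/
theorem cross_gradient_potential_of_local_of_isOpen {S : Set ℝ} {Θ : ℝ → (EuclideanSpace ℝ (Fin 3)) → ℝ}
    {x x₀ : (EuclideanSpace ℝ (Fin 3))} {t : ℝ} {N : Set (EuclideanSpace ℝ (Fin 3))} (hS : IsOpen S)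
    (hV : IsVorticitySolutionOn S 1 v) (hΘ : IsSmoothSpaceTimeOn S Θ) (ht : t ∈ S)
    (hN : N ∈ 𝓝 x) (hrep : ∀ s ∈ S, ∀ z ∈ N, curl (v s) z = cross (gradient (Θ s) z) (z - x₀)) :
    cross (gradient (fun z => deriv (fun s => Θ s z) t + ⟪v t z, gradient (Θ t) z⟫ - (Δ (Θ t)) z) x)
        (x - x₀) =
      cross (gradient (fun z => ⟪v t z, z - x₀⟫) x) (gradient (Θ t) x) := by
  have ht' : t ∈ S := ht
  have hxN : x ∈ N := mem_of_mem_nhds hN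
  set b := EuclideanSpace.basisFun (Fin 3) ℝ with hb_def
  have hb : ∀ i, b i = EuclideanSpace.single i (1 : ℝ) := fun i => by simp [hb_def]
  -- the slices at time `t`
  set θ : (EuclideanSpace ℝ (Fin 3)) → ℝ := Θ t with hθ_def
  set u : (EuclideanSpace ℝ (Fin 3)) → (EuclideanSpace ℝ (Fin 3)) := v t with hu_def
  set y : (EuclideanSpace ℝ (Fin 3)) := x - x₀ with hy_def
  set Θₜ : (EuclideanSpace ℝ (Fin 3)) → ℝ := fun z => deriv (fun s => Θ s z) t with hΘₜ_def
  have hθ : ContDiff ℝ ∞ θ := hΘ.contDiff_slice ht'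
  have hu : ContDiff ℝ ∞ u := hV.smooth_velocity.contDiff_slice ht'
  have hΘₜ : ContDiff ℝ ∞ Θₜ := (hΘ.isSmoothSpaceTimeOn_deriv hS).contDiff_slice ht'
  have hθ2 : ContDiff ℝ 2 θ := hθ.of_le (by norm_cast)
  have hθ3 : ContDiff ℝ 3 θ := hθ.of_le (by norm_cast)
  set A : (EuclideanSpace ℝ (Fin 3)) → (EuclideanSpace ℝ (Fin 3)) := gradient θ with hA_def
  have hA : ContDiff ℝ ∞ A := contDiff_gradient_top hθ
  have hA2 : ContDiff ℝ 2 A := hA.of_le (by norm_cast)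
  have hAd : Differentiable ℝ A := hA.differentiable (by simp)
  have hud : Differentiable ℝ u := hu.differentiable (by simp)
  -- the partial derivatives of `A`
  have hAi : ∀ c : (EuclideanSpace ℝ (Fin 3)), ContDiff ℝ 1 fun z => fderiv ℝ A z c := fun c =>
    (hA2.fderiv_right (m := 1) le_rfl).clm_apply contDiff_const
  -- the point data
  set a : (EuclideanSpace ℝ (Fin 3)) := A x with ha_def
  set V : (EuclideanSpace ℝ (Fin 3)) := u x with hV_def
  set M : (EuclideanSpace ℝ (Fin 3)) →L[ℝ] (EuclideanSpace ℝ (Fin 3)) := fderiv ℝ u x with hM_def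
  set H : Fin 3 → (EuclideanSpace ℝ (Fin 3)) := fun i => fderiv ℝ A x (EuclideanSpace.single i (1 : ℝ)) with hH_def
  set Q : (EuclideanSpace ℝ (Fin 3)) := fderiv ℝ A x V with hQ_def
  set P : (EuclideanSpace ℝ (Fin 3)) := gradient Θₜ x with hP_def
  set R : (EuclideanSpace ℝ (Fin 3)) := gradient (Δ θ) x with hR_def
  set G : (EuclideanSpace ℝ (Fin 3)) := gradient (fun z => ⟪u z, A z⟫) x with hG_def
  set n : (EuclideanSpace ℝ (Fin 3)) := gradient (fun z => ⟪u z, z - x₀⟫) x with hn_def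
  -- (tr) `tr M = div v(t)(x) = 0`
  have htr : ∑ m, M (EuclideanSpace.single m (1 : ℝ)) m = 0 := by
    have h := hV.divFree t ht' x
    rw [VectorCalculus.divergence, trace_eq_sum_coord] at h
    exact h
  -- (H) the Hessian is symmetric
  have hH : ∀ i j, H i j = H j i := by
    intro i j
    have hsymm : IsSymmSndFDerivAt ℝ θ x := hθ2.contDiffAt.isSymmSndFDerivAt (by simp)
    simp only [hH_def, hA_def]
    rw [fderiv_gradient_single_apply θ hθ2 x j i, fderiv_gradient_single_apply θ hθ2 x i j]
    exact hsymm.eq _ _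
  -- (Q) `Q = Σⱼ Vⱼ Hⱼ`
  have hQ : ∀ k, Q k = ∑ j, V j * H j k := fun k => clm_apply_coord (fderiv ℝ A x) V k
  -- (G) `∇⟪u, A⟫ = Mᵀ a + H V`
  have hG : ∀ i, G i = ⟪M (EuclideanSpace.single i (1 : ℝ)), a⟫ + ⟪V, H i⟫ := by
    intro i
    rw [hG_def, gradient_coord, fderiv_inner_apply ℝ (hud x) (hAd x)]
    simp only [hM_def, ha_def, hV_def, hH_def]
    ring
  -- (n) `∇⟪u, y⟫ = Mᵀ y + V`
  have hn : ∀ i, n i = ⟪M (EuclideanSpace.single i (1 : ℝ)), y⟫ + V i := by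
    intro i
    have hid : DifferentiableAt ℝ (fun z : (EuclideanSpace ℝ (Fin 3)) => z - x₀) x := differentiableAt_id.sub_const x₀
    rw [hn_def, gradient_coord, fderiv_inner_apply ℝ (hud x) hid, fderiv_sub_const, fderiv_fun_id]
    simp only [ContinuousLinearMap.coe_id', id_eq, hM_def, hV_def, hy_def,
      EuclideanSpace.inner_single_right, one_mul, RCLike.conj_to_real]
    ring
  -- ### the representation near `x` at time `t`, and the derivative of such fields
  set W : (EuclideanSpace ℝ (Fin 3)) → (EuclideanSpace ℝ (Fin 3)) := fun z => cross (A z) (z - x₀) with hW_def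
  have hWeq : curl u =ᶠ[𝓝 x] W := by
    filter_upwards [hN] with z hz
    exact hrep t ht z hz
  have hcurlx : curl u x = cross a y := hrep t ht x hxN
  have hDcross : ∀ (B : (EuclideanSpace ℝ (Fin 3)) → (EuclideanSpace ℝ (Fin 3))), Differentiable ℝ B → ∀ z w : (EuclideanSpace ℝ (Fin 3)),
      fderiv ℝ (fun z => cross (B z) (z - x₀)) z w = cross (B z) w + cross (fderiv ℝ B z w) (z - x₀) := by
    intro B hB z w
    rw [(hasFDerivAt_cross (hB z).hasFDerivAt (hasFDerivAt_sub_const x₀)).fderiv]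
    simp only [_root_.add_apply, ContinuousLinearMap.precompR_apply,
      ContinuousLinearMap.compL_apply, ContinuousLinearMap.coe_comp, Function.comp_apply,
      ContinuousLinearMap.precompL_apply, crossCLM_apply, ContinuousLinearMap.coe_id', id_eq]
  -- ### (T1) the time derivative: `∂ₜ ω(t, x) = ∇Θₜ(x) × y`
  have hω : IsSmoothSpaceTimeOn S (vorticity v) := by
    have e : vorticity v = fun s z => curlCLM (fderiv ℝ (v s) z) := by
      funext s z; rfl
    rw [e]
    exact (hV.smooth_velocity.fderiv_slice hS.uniqueDiffOn).clm curlCLM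
  have hT1 : deriv (fun s => curl (v s) x) t = cross P y := by
    have hc : HasDerivAt (fun s => curl (v s) x) (deriv (fun s => curl (v s) x) t) t :=
      hω.hasDerivAt_timeLine hS ht' x
    have hPj : ∀ j : Fin 3, HasDerivAt (fun s => fderiv ℝ (Θ s) x (EuclideanSpace.single j (1 : ℝ))) (P j) t := by
      intro j
      rw [hP_def, gradient_coord]
      exact hΘ.hasDerivAt_fderiv_slice hS ht' x (EuclideanSpace.single j (1 : ℝ))
    have hci : ∀ i : Fin 3,
        HasDerivAt (fun s => curl (v s) x i) (deriv (fun s => curl (v s) x) t i) t := fun i => by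
      have h := (EuclideanSpace.proj i).hasFDerivAt.comp_hasDerivAt t hc
      simpa [Function.comp_def] using h
    have hev : ∀ᶠ s in 𝓝 t, curl (v s) x = cross (gradient (Θ s) x) y := by
      filter_upwards [hS.mem_nhds ht'] with s hs
      exact hrep s hs x hxN
    have e0 : deriv (fun s => curl (v s) x) t 0 = (cross P y) 0 := by
      have h1 : HasDerivAt (fun s => fderiv ℝ (Θ s) x (EuclideanSpace.single 1 (1 : ℝ)) * y 2 - fderiv ℝ (Θ s) x (EuclideanSpace.single 2 (1 : ℝ)) * y 1)
          (P 1 * y 2 - P 2 * y 1) t := ((hPj 1).mul_const _).sub ((hPj 2).mul_const _)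
      have h2 : (fun s => curl (v s) x 0) =ᶠ[𝓝 t]
          fun s => fderiv ℝ (Θ s) x (EuclideanSpace.single 1 (1 : ℝ)) * y 2 - fderiv ℝ (Θ s) x (EuclideanSpace.single 2 (1 : ℝ)) * y 1 := by
        filter_upwards [hev] with s hs
        rw [hs, cross_apply_zero, gradient_coord, gradient_coord]
      rw [cross_apply_zero, ← (hci 0).deriv, h2.deriv_eq, h1.deriv]
    have e1 : deriv (fun s => curl (v s) x) t 1 = (cross P y) 1 := by
      have h1 : HasDerivAt (fun s => fderiv ℝ (Θ s) x (EuclideanSpace.single 2 (1 : ℝ)) * y 0 - fderiv ℝ (Θ s) x (EuclideanSpace.single 0 (1 : ℝ)) * y 2)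
          (P 2 * y 0 - P 0 * y 2) t := ((hPj 2).mul_const _).sub ((hPj 0).mul_const _)
      have h2 : (fun s => curl (v s) x 1) =ᶠ[𝓝 t]
          fun s => fderiv ℝ (Θ s) x (EuclideanSpace.single 2 (1 : ℝ)) * y 0 - fderiv ℝ (Θ s) x (EuclideanSpace.single 0 (1 : ℝ)) * y 2 := by
        filter_upwards [hev] with s hs
        rw [hs, cross_apply_one, gradient_coord, gradient_coord]
      rw [cross_apply_one, ← (hci 1).deriv, h2.deriv_eq, h1.deriv]
    have e2 : deriv (fun s => curl (v s) x) t 2 = (cross P y) 2 := by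
      have h1 : HasDerivAt (fun s => fderiv ℝ (Θ s) x (EuclideanSpace.single 0 (1 : ℝ)) * y 1 - fderiv ℝ (Θ s) x (EuclideanSpace.single 1 (1 : ℝ)) * y 0)
          (P 0 * y 1 - P 1 * y 0) t := ((hPj 0).mul_const _).sub ((hPj 1).mul_const _)
      have h2 : (fun s => curl (v s) x 2) =ᶠ[𝓝 t]
          fun s => fderiv ℝ (Θ s) x (EuclideanSpace.single 0 (1 : ℝ)) * y 1 - fderiv ℝ (Θ s) x (EuclideanSpace.single 1 (1 : ℝ)) * y 0 := by
        filter_upwards [hev] with s hs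
        rw [hs, cross_apply_two, gradient_coord, gradient_coord]
      rw [cross_apply_two, ← (hci 2).deriv, h2.deriv_eq, h1.deriv]
    exact PeriodicCylinder.ext3 e0 e1 e2
  -- ### (T2) the convective term: `Dω(x)[V] = a × V + (D∇Θ V) × y`
  have hT2 : fderiv ℝ (curl u) x V = cross a V + cross Q y := by
    rw [hWeq.fderiv_eq]
    exact hDcross A hAd x V
  -- ### (T4) the Laplacian: `Δω(x) = ∇(Δθ)(x) × y`
  have hT4 : (Δ (curl u)) x = cross R y := by
    rw [(InnerProductSpace.laplacian_congr_nhds hWeq).eq_of_nhds]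
    have hW : ContDiff ℝ 2 W :=
      (crossCLM.contDiff.comp hA2).clm_apply (contDiff_id.sub contDiff_const)
    rw [laplacian_eq_sum_fderiv_fderiv b hW x]
    -- second derivatives at `x`
    have hD2 : ∀ i, fderiv ℝ (fun z => fderiv ℝ W z (b i)) x (b i) =
        cross (fderiv ℝ A x (b i)) (b i) + (cross (fderiv ℝ A x (b i)) (b i) +
          cross (fderiv ℝ (fun z => fderiv ℝ A z (b i)) x (b i)) (x - x₀)) := by
      intro i
      have hD1 : (fun z => fderiv ℝ W z (b i)) =
          fun z => cross (A z) (b i) + cross (fderiv ℝ A z (b i)) (z - x₀) := by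
        funext z; exact hDcross A hAd z (b i)
      rw [hD1]
      have hf1 : DifferentiableAt ℝ (fun z => cross (A z) (b i)) x :=
        (hasFDerivAt_cross (hAd x).hasFDerivAt (hasFDerivAt_const (b i) x)).differentiableAt
      have hB : Differentiable ℝ (fun z => fderiv ℝ A z (b i)) :=
        (hAi (b i)).differentiable one_ne_zero
      have hf2 : DifferentiableAt ℝ (fun z => cross (fderiv ℝ A z (b i)) (z - x₀)) x :=
        (hasFDerivAt_cross (hB x).hasFDerivAt (hasFDerivAt_sub_const x₀)).differentiableAt
      rw [fderiv_fun_add hf1 hf2, _root_.add_apply]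
      have e1 : fderiv ℝ (fun z => cross (A z) (b i)) x (b i) = cross (fderiv ℝ A x (b i)) (b i) := by
        rw [(hasFDerivAt_cross (hAd x).hasFDerivAt (hasFDerivAt_const (b i) x)).fderiv]
        simp only [_root_.add_apply, ContinuousLinearMap.precompR_apply,
          ContinuousLinearMap.compL_apply, ContinuousLinearMap.coe_comp, Function.comp_apply,
          ContinuousLinearMap.precompL_apply, crossCLM_apply, _root_.zero_apply,
          cross_zero_right, zero_add]
      rw [e1, hDcross _ hB x (b i)]
    rw [Finset.sum_congr rfl fun i _ => hD2 i, Finset.sum_add_distrib, Finset.sum_add_distrib]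
    -- `Σᵢ ∂ᵢ∂ᵢ A = ΔA = ∇Δθ`
    have hΔA : ∑ i, fderiv ℝ (fun z => fderiv ℝ A z (b i)) x (b i) = R := by
      rw [← laplacian_eq_sum_fderiv_fderiv b hA2 x]
      have hk : ∀ k : Fin 3, (Δ A) x k = R k := by
        intro k
        have h1 := hA2.contDiffAt.laplacian_CLM_comp_left (l := EuclideanSpace.proj k) (x := x)
        have h2 : (⇑(EuclideanSpace.proj k) ∘ A) = fun z => fderiv ℝ θ z (EuclideanSpace.single k (1 : ℝ)) := by
          funext z
          simp only [Function.comp_apply, hA_def]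
          rw [← gradient_coord]
          rfl
        rw [h2] at h1
        have h3 : (Δ A) x k = (Δ fun z => fderiv ℝ θ z (EuclideanSpace.single k (1 : ℝ))) x := by
          rw [h1]; rfl
        rw [h3, ← fderiv_laplacian_apply hθ3 x (EuclideanSpace.single k (1 : ℝ)), hR_def, gradient_coord]
      exact PeriodicCylinder.ext3 (hk 0) (hk 1) (hk 2)
    have hsumY : ∑ i, cross (fderiv ℝ (fun z => fderiv ℝ A z (b i)) x (b i)) (x - x₀) = cross R y := by
      rw [← hΔA]
      simp only [← crossCLM_apply]
      rw [map_sum, _root_.sum_apply]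
    -- `Σᵢ ∂ᵢA × eᵢ = 0` (symmetry of the Hessian)
    have hsumX : ∑ i, cross (fderiv ℝ A x (b i)) (b i) = 0 := by
      have s01 : fderiv ℝ A x (EuclideanSpace.single 0 (1 : ℝ)) 1 = fderiv ℝ A x (EuclideanSpace.single 1 (1 : ℝ)) 0 := hH 0 1
      have s02 : fderiv ℝ A x (EuclideanSpace.single 0 (1 : ℝ)) 2 = fderiv ℝ A x (EuclideanSpace.single 2 (1 : ℝ)) 0 := hH 0 2
      have s12 : fderiv ℝ A x (EuclideanSpace.single 1 (1 : ℝ)) 2 = fderiv ℝ A x (EuclideanSpace.single 2 (1 : ℝ)) 1 := hH 1 2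
      simp only [Fin.sum_univ_three, hb]
      refine PeriodicCylinder.ext3 ?_ ?_ ?_
      · simp only [PiLp.add_apply, cross_apply_zero, PiLp.zero_apply]
        simp
        linarith
      · simp only [PiLp.add_apply, cross_apply_one, PiLp.zero_apply]
        simp
        linarith
      · simp only [PiLp.add_apply, cross_apply_two, PiLp.zero_apply]
        simp
        linarith
    rw [hsumX, hsumY, zero_add, zero_add]
  -- ### the gradient of `F = Θₜ + ⟪u, A⟫ − Δθ`
  have hgradF : gradient (fun z => Θₜ z + ⟪u z, A z⟫ - (Δ θ) z) x = P + G - R := by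
    have hd1 : DifferentiableAt ℝ Θₜ x := (hΘₜ.differentiable (by simp)) x
    have hd2 : DifferentiableAt ℝ (fun z => ⟪u z, A z⟫) x :=
      ((hu.inner ℝ hA).differentiable (by simp)) x
    have hd3 : DifferentiableAt ℝ (Δ θ) x :=
      ((contDiff_laplacian_of_contDiff_infty hθ).differentiable (by simp)) x
    simp only [hP_def, hG_def, hR_def, gradient]
    rw [fderiv_fun_sub (f := fun z => Θₜ z + ⟪u z, A z⟫) (hd1.add hd2) hd3,
      fderiv_fun_add hd1 hd2, map_sub, map_add]
  -- ### the vorticity equation at `(t, x)` and the algebra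
  have heq := hV.vorticity_eq t ht' x
  rw [timeDerivWithin_eq_deriv hS ht', one_smul] at heq
  simp only [vorticity_apply, convect_apply] at heq
  rw [hT1, hT2, hcurlx, hT4] at heq
  have hmain := cross_eq_of_vorticity_identity M a y V P Q R G n H htr hG hQ hH hn heq
  have hF : (fun z => deriv (fun s => Θ s z) t + ⟪v t z, gradient (Θ t) z⟫ - (Δ (Θ t)) z) =
      fun z => Θₜ z + ⟪u z, A z⟫ - (Δ θ) z := rfl
  rw [hF, hgradF]
  exact hmain


/-! ### Localisation: potential smooth on the punctured slab, open window -/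

/-- **The (E1)-half of stub `stub_windowPotentialLaw` of the registered birth skeleton of crux `UnthreadedRigidity`
(stmt-NavierStokesRegularity-27585; LINE «jet rigidity», planner ns-idea-6 g5, sha16 `5d320f85a8de9ffc`), binders and
conclusion VERBATIM from `StubWindowPotentialLaw` (the existence of `T` being the other half).** For an open time set
`S`, a classical solution `v` of the vorticity formulation on `S` (unit viscosity) and a potential `T`, jointly smooth
on `S × (ℝ³ ∖ {x₀})`, with `curl v(t) = ∇T(t) × (x − x₀)` on `S × ℝ³`:
`∇(∂ₜT + ⟪v, ∇T⟫ − ΔT) × (x − x₀) = ∇⟪v, x − x₀⟫ × ∇T` at every `t ∈ S`, `x ≠ x₀`. Localise with a bump `φ ≡ 1` near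
`x` supported away from `x₀` and apply `cross_gradient_potential_of_local_of_isOpen`. [folklore] -/
theorem potentialEvolution_of_isOpen :
    ∀ (S : Set ℝ) (v : ℝ → EuclideanSpace ℝ (Fin 3) → EuclideanSpace ℝ (Fin 3)) (x₀ : EuclideanSpace ℝ (Fin 3))
      (T : ℝ → EuclideanSpace ℝ (Fin 3) → ℝ), IsOpen S →
      Literature.Analysis.FluidPDE.IsVorticitySolutionOn S 1 v →
      ContDiffOn ℝ (⊤ : ℕ∞) (Function.uncurry T) (S ×ˢ ({x₀}ᶜ : Set (EuclideanSpace ℝ (Fin 3)))) →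
      (∀ t ∈ S, ∀ x, Literature.Analysis.FluidPDE.curl (v t) x =
        Literature.Analysis.FluidPDE.cross (gradient (T t) x) (x - x₀)) →
      ∀ t ∈ S, ∀ x, x ≠ x₀ →
        Literature.Analysis.FluidPDE.cross
            (gradient (fun z => deriv (fun s => T s z) t + inner ℝ (v t z) (gradient (T t) z)
              - Laplacian.laplacian (T t) z) x) (x - x₀) =
          Literature.Analysis.FluidPDE.cross (gradient (fun z => inner ℝ (v t z) (z - x₀)) x)
            (gradient (T t) x) := by
  intro S v x₀ T hS hV hT hrep t ht x hx
  -- a bump `φ ≡ 1` on `B(x, r/4)`, supported in `B̄(x, r/2)`, `r = |x − x₀|`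
  have hr : 0 < dist x x₀ := dist_pos.2 hx
  set r : ℝ := dist x x₀ with hr_def
  let φ : ContDiffBump x := ⟨r / 4, r / 2, by positivity, by linarith⟩
  have hφ1 : ∀ z ∈ Metric.ball x (r / 4), φ z = 1 := fun z hz =>
    φ.one_of_mem_closedBall (Metric.ball_subset_closedBall hz)
  have hφ0 : (φ : (EuclideanSpace ℝ (Fin 3)) → ℝ) =ᶠ[𝓝 x₀] 0 := by
    refine notMem_tsupport_iff_eventuallyEq.1 ?_
    rw [φ.tsupport_eq]
    simp only [Metric.mem_closedBall, not_le, dist_comm x₀ x]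
    show r / 2 < r
    linarith
  -- the localised potential
  set Θ : ℝ → (EuclideanSpace ℝ (Fin 3)) → ℝ := fun s z => φ z * T s z with hΘ_def
  have hΘT : ∀ s, ∀ z ∈ Metric.ball x (r / 4), Θ s z = T s z := fun s z hz => by
    simp only [hΘ_def, hφ1 z hz, one_mul]
  have hslice : ∀ s, ∀ z ∈ Metric.ball x (r / 4), Θ s =ᶠ[𝓝 z] T s := fun s z hz => by
    filter_upwards [Metric.isOpen_ball.mem_nhds hz] with w hw
    exact hΘT s w hw
  have hgrad : ∀ s, ∀ z ∈ Metric.ball x (r / 4), gradient (Θ s) z = gradient (T s) z :=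
    fun s z hz => by rw [gradient, gradient, (hslice s z hz).fderiv_eq]
  -- (a) `Θ` is jointly smooth on the whole slab
  have hΘ : IsSmoothSpaceTimeOn S Θ := by
    rintro ⟨s, z⟩ ⟨hs, -⟩
    by_cases hz : z = x₀
    · -- near `(s, x₀)` the localised potential vanishes
      have h1 : (fun q : ℝ × (EuclideanSpace ℝ (Fin 3)) => (φ : (EuclideanSpace ℝ (Fin 3)) → ℝ) q.2) =ᶠ[𝓝 (s, z)] fun q => (0 : (EuclideanSpace ℝ (Fin 3)) → ℝ) q.2 := by
        have hc : Tendsto (fun q : ℝ × (EuclideanSpace ℝ (Fin 3)) => q.2) (𝓝 (s, z)) (𝓝 x₀) := by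
          rw [← hz]; exact continuous_snd.tendsto _
        exact hφ0.comp_tendsto hc
      have h2 : uncurry Θ =ᶠ[𝓝 (s, z)] fun _ => (0 : ℝ) := by
        filter_upwards [h1] with q hq
        simp only [Pi.zero_apply] at hq
        simp only [uncurry, hΘ_def, hq, zero_mul]
      exact (contDiffAt_const.congr_of_eventuallyEq h2).contDiffWithinAt
    · have hU : S ×ˢ ({x₀}ᶜ : Set (EuclideanSpace ℝ (Fin 3))) ∈ 𝓝 ((s, z) : ℝ × (EuclideanSpace ℝ (Fin 3))) :=
        (hS.prod isOpen_compl_singleton).mem_nhds ⟨hs, hz⟩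
      have hTp : ContDiffAt ℝ ∞ (uncurry T) (s, z) := (hT (s, z) ⟨hs, hz⟩).contDiffAt hU
      have hφp : ContDiffAt ℝ ∞ (fun q : ℝ × (EuclideanSpace ℝ (Fin 3)) => (φ : (EuclideanSpace ℝ (Fin 3)) → ℝ) q.2) (s, z) :=
        φ.contDiff.contDiffAt.comp (s, z) contDiffAt_snd
      have h3 : uncurry Θ = fun q : ℝ × (EuclideanSpace ℝ (Fin 3)) => (φ : (EuclideanSpace ℝ (Fin 3)) → ℝ) q.2 * uncurry T q := by
        funext q; rfl
      rw [h3]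
      exact (hφp.mul hTp).contDiffWithinAt
  -- (b) the representation near `x` through `Θ`
  have hN : Metric.ball x (r / 4) ∈ 𝓝 x := Metric.isOpen_ball.mem_nhds (Metric.mem_ball_self (by positivity))
  have hrepΘ : ∀ s ∈ S, ∀ z ∈ Metric.ball x (r / 4), curl (v s) z = cross (gradient (Θ s) z) (z - x₀) :=
    fun s hs z hz => by rw [hgrad s z hz]; exact hrep s hs z
  -- (c) the core law for `Θ`, transferred back to `T` at `x`
  have hcore := cross_gradient_potential_of_local_of_isOpen hS hV hΘ ht hN hrepΘ
  have hxB : x ∈ Metric.ball x (r / 4) := Metric.mem_ball_self (by positivity)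
  have hF : (fun z => deriv (fun s => Θ s z) t + ⟪v t z, gradient (Θ t) z⟫ - (Δ (Θ t)) z) =ᶠ[𝓝 x]
      fun z => deriv (fun s => T s z) t + ⟪v t z, gradient (T t) z⟫ - (Δ (T t)) z := by
    filter_upwards [hN] with z hz
    have e1 : (fun s => Θ s z) = fun s => T s z := funext fun s => hΘT s z hz
    rw [e1, hgrad t z hz, (InnerProductSpace.laplacian_congr_nhds (hslice t z hz)).eq_of_nhds]
  rw [gradient, hF.fderiv_eq, hgrad t x hxB] at hcore
  exact hcore

end Summit.NavierStokesRegularity.NavierStokesRegularity.Theorems.PoloidalLiouville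

end
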